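import Summits.HodgeConjecture.HodgeConjecture.Theorems.Ring2HypothesesDescentAbsoluteOffset
import Literature.AlgebraicGeometry.Motives.AbelianVarietyProjective
import HarnessLib

/-!
# Ring 2 — hypotheses layer, descent axis: THE `ℚ̄`-NODE `AbsoluteHodgeImpliesAlgebraicQbar` LIVES IN EVERY FIXED OFFSET FROM THE
# MIDDLE DEGREE, and — with Voisin 2007 — the PARENT node is "absolute Hodge classes in the middle degree of smooth projective
# varieties DEFINED OVER `ℚ̄` are algebraic" (modulo (N)+(E)+(c), resp. + c7)

HONEST FRAMING (page 1, verbatim the cell's standing line): **research route conditional on HC_CM; not a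
corollary; Q11.4-sentence-2 already refuted in dim ≥ 3.** Nothing in this file proves a case of the Hodge conjecture;
nothing discharges the binder of record b06 `Ring2.Hypotheses.AbsoluteHodgeImpliesAlgebraicAV`, its parent node
`AbsoluteHodgeImpliesAlgebraic` or the `ℚ̄`-variant `AbsoluteHodgeImpliesAlgebraicQbar` (`Ring2HypothesesDescent.lean` :73 / :66 /
:81; all OPEN); the binder table's numbers do not move. `HC_CM` (`Theses.RankFourFaces.CMAbelianHodge`) does not occur in this
file; `HC_AV` is not asserted; Voisin's Prop. 1.2 (`voisin2007_hodgeConjecture_absolute_of_qbar`, c7) is a named fact displayed as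
a hypothesis in §4 only.

Hodge ladder STAGE 3, `BINDER-OWNERS.md` row **b06**, seat `ring2-b06` (gen 72), fifth file of the gen. The second file of this gen
(`Ring2HypothesesDescentAbsoluteOffset`) moved an absolute Hodge class to any prescribed offset `2q − N` by padding with a complex
abelian variety `B` (bare pull-back DOWN, `κʲ`-cup UP) — on ALL smooth projective complex varieties. The `ℚ̄`-node quantifies over
varieties `X₀ ⊗_ι ℂ` DEFINED OVER `ℚ̄`, a class NOT obviously closed under those paddings; it is, because (i) abelian varieties of
every dimension exist over `ℚ̄` (powers of `y² = x³ + …`, `exists_abelianVariety_dim_eq_succ (AlgebraicClosure ℚ)`) and base-change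
to `ℂ` along `ι` as abelian varieties of the same dimension (`AbelianVariety.baseChange`, `dim_baseChange`), and (ii) BASE CHANGE
COMMUTES WITH PRODUCTS: `(X₀ ⊗ B₀) ⊗_ι ℂ ≅ (X₀ ⊗_ι ℂ) ⊗ (B₀ ⊗_ι ℂ)` (`baseChangeHom ι = Over.pullback` is a right adjoint, hence
preserves binary products; Mathlib's `CartesianMonoidalCategory.prodComparisonIso`). Absolute Hodge classes and algebraic classes
transport along isomorphisms ((N)+(E), resp. fact-free), so:

* §0 `forall_absoluteHodge_algebraic_of_iso_of_canonical` (transport of "AH ⟹ algebraic in codimension `q`" along `Y ≅ Y'`);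
* §1 `nonempty_baseChangeHom_tensor_iso`, `exists_abelianVariety_tensor_iso_baseChangeHom` (for `X ≅ X₀ ⊗_ι ℂ` and every `g`: an
  abelian `B` of dimension `g + 1` with `X ⊗ B.X ≅ (X₀ ⊗ B₀.X) ⊗_ι ℂ`);
* §2 per variety isomorphic to a base change: offset `−k` / `+k` paddings inside the `ℚ̄`-world;
* §3 **`absoluteHodgeImpliesAlgebraicQbar_iff_belowMiddleBy_of_canonical k` / `…_aboveMiddleBy_… k`: the `ℚ̄`-NODE `↔` "for every
  `ι : ℚ̄ →+* ℂ` and every `Y₀/ℚ̄` with `Y₀ ⊗_ι ℂ` smooth projective of dimension `2q + k` (resp. `2q − k`, `2 ≤ q ≤ dim − 2`), every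
  absolute Hodge class of codimension `q` on `Y₀ ⊗_ι ℂ` is algebraic"**, for EVERY `k` (modulo (N)+(E)+(c)); `k = 0`:
  `…_iff_middleDegree_…`;
* §4 **WITH VOISIN (c7): `absoluteHodgeImpliesAlgebraic_iff_qbar_middleDegree_of_voisin_of_canonical` — the PARENT node (Charles–Schnell
  Conj. 11.2.18 for all smooth projective complex varieties) `↔` "for ONE (any) embedding `ι : ℚ̄ →+* ℂ`: absolute Hodge classes in the
  MIDDLE degree `H^{2m}` of smooth projective `Y₀ ⊗_ι ℂ`, `Y₀` DEFINED OVER `ℚ̄`, `2m ≥ 4`, are algebraic"** (and the offset-`±k`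
  forms) — Voisin's Prop. 1.2 / Rem. 1.4 ("the Hodge conjecture for absolute Hodge classes reduces to varieties defined over `ℚ̄`")
  composed with the padding; c7, (N), (E), (c) displayed, nothing asserted. Row b06 follows from the same `ℚ̄`-middle hypothesis
  (`absoluteHodgeImpliesAlgebraicAV_of_qbar_middleDegree_of_voisin_of_canonical`).

HONEST COLUMN. Nothing is discharged; «10 · 0» unchanged; the three nodes and `HC_AV` are OPEN and NOT asserted; c7, (N), (E)/(G), (c)
are named facts displayed as hypotheses; no definition (the product/base-change isomorphism is recorded as `Nonempty`, not as data),
no named fact, no sorry. NOT claimed: primitive forms over `ℚ̄` (the sequel file), anything about `σ`-conjugate varieties, any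
descent of the CLASS (only of the variety) to `ℚ̄`.

References (bib keys): Voisin2007HodgeLoci (Prop. 1.2, Rem. 1.4, §0), Deligne1982HodgeCycles (§2 Ex. 2.1 (c), (d) p. 16),
CharlesSchnell2014Notes (Def. 11.2.3, §11.2.2 (11.2.2)–(11.2.3), Conj. 11.2.18, §11.2.5), Hartshorne1977 (II.3 "base extension",
II Thm. 3.3 products), GrothendieckTopology1969 (§1), BrosnanFangNiePearlstein2009 (§6 Lemma 48),
MumfordAV1970 (§1, §4), SilvermanAEC2009 (III.3.6). -/

noncomputable section

set_option linter.dupNamespace false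

open CategoryTheory CategoryTheory.Limits AlgebraicGeometry MonoidalCategory CartesianMonoidalCategory
open Literature.AlgebraicTopology.SingularHomology Literature.Geometry.Kaehler
open Literature.AlgebraicGeometry Literature.AlgebraicGeometry.Motives
open Literature.AlgebraicGeometry.HodgeTheory
open Summit.HodgeConjecture.HodgeConjecture.Theorems

namespace Summit.HodgeConjecture.HodgeConjecture.Ring2.Hypotheses

/-! ## §0 Transport along isomorphisms (modulo (N)+(E)) -/

section Transport

variable {n : ℕ} {Y Y' : SchemeOver ℂ}

/-- **"Absolute Hodge ⟹ algebraic in codimension `q`" transports along an isomorphism `e : Y ≅ Y'`** (modulo (N)+(E)): an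
absolute Hodge class `z` on `Y'` pulls back to an absolute Hodge class `e^* z` on `Y` (`absolutePullback_of_canonical`), which is
algebraic by hypothesis, and algebraic classes transport back along isomorphisms (`mem_algebraicClasses_map_iff_of_iso`, fact-free).
[cite: CharlesSchnell2014Notes, §11.2.2 (11.2.2)–(11.2.3)] [cite: GrothendieckTopology1969, §1] -/
theorem forall_absoluteHodge_algebraic_of_iso_of_canonical (hN : chartConjugation_canonical)
    (hex : ∀ ⦃n : ℕ⦄ ⦃X : SchemeOver ℂ⦄, IsSmoothProjective n X →
      ∀ (σ : ℂ ≃+* ℂ) (p : ℕ) (c : complexBetti X (2 * p)), ∃ s, IsConjugateClass σ X (2 * p) c s)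
    (hY : IsSmoothProjective n Y) (hY' : IsSmoothProjective n Y') (e : Y ≅ Y') {q : ℕ}
    (h : ∀ z : complexBetti Y (2 * q), IsAbsoluteHodgeClass n Y q z → z ∈ algebraicClasses Y q)
    (z : complexBetti Y' (2 * q)) (hz : IsAbsoluteHodgeClass n Y' q z) : z ∈ algebraicClasses Y' q :=
  (mem_algebraicClasses_map_iff_of_iso e).1 (h _ (absolutePullback_of_canonical hN hex hY hY' e.hom q z hz))

end Transport

/-! ## §1 Base change along `ι : ℚ̄ →+* ℂ` commutes with products; padding varieties defined over `ℚ̄` -/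

section BaseChange

variable (ι : AlgebraicClosure ℚ →+* ℂ)

/-- **Base change commutes with products**: `(X₀ ⊗ Y₀) ⊗_ι ℂ ≅ (X₀ ⊗_ι ℂ) ⊗ (Y₀ ⊗_ι ℂ)` — `baseChangeHom ι` is Mathlib's
`Over.pullback`, a right adjoint (`Over.mapPullbackAdj`), hence preserves the binary products of the cartesian monoidal structures
(`CartesianMonoidalCategory.prodComparisonIso`). Recorded as `Nonempty` (no data). [cite: Hartshorne1977, II.3 (base extension) and II Thm. 3.3] -/
theorem nonempty_baseChangeHom_tensor_iso (X₀ Y₀ : SchemeOver (AlgebraicClosure ℚ)) :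
    Nonempty ((baseChangeHom ι).obj (X₀ ⊗ Y₀) ≅ (baseChangeHom ι).obj X₀ ⊗ (baseChangeHom ι).obj Y₀) := by
  haveI : PreservesLimitsOfShape (Discrete WalkingPair) (baseChangeHom ι) := by
    unfold baseChangeHom
    infer_instance
  exact ⟨CartesianMonoidalCategory.prodComparisonIso (baseChangeHom ι) X₀ Y₀⟩

/-- **Padding varieties defined over `ℚ̄`**: for `X ≅ X₀ ⊗_ι ℂ` and every `g` there are a complex abelian variety `B` of dimension
`g + 1` and a `ℚ̄`-scheme `Y₀` with `X ⊗ B.X ≅ Y₀ ⊗_ι ℂ` — `B = B₀ ⊗_ι ℂ` for an abelian variety `B₀` of dimension `g + 1` over `ℚ̄`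
(`exists_abelianVariety_dim_eq_succ`, `AbelianVariety.baseChange`, `dim_baseChange`) and `Y₀ = X₀ ⊗ B₀`
(`nonempty_baseChangeHom_tensor_iso`). [cite: MumfordAV1970, §1 and §4] [cite: SilvermanAEC2009, III.3.6]
[cite: Hartshorne1977, II.3 (base extension)] -/
theorem exists_abelianVariety_tensor_iso_baseChangeHom {X : SchemeOver ℂ} {X₀ : SchemeOver (AlgebraicClosure ℚ)}
    (e : X ≅ (baseChangeHom ι).obj X₀) (g : ℕ) :
    ∃ (B : AbelianVariety ℂ) (Y₀ : SchemeOver (AlgebraicClosure ℚ)),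
      B.dim = g + 1 ∧ Nonempty (X ⊗ B.X ≅ (baseChangeHom ι).obj Y₀) := by
  letI := ι.toAlgebra
  obtain ⟨B₀, hB₀⟩ := exists_abelianVariety_dim_eq_succ (AlgebraicClosure ℚ) g
  obtain ⟨φ⟩ := nonempty_baseChangeHom_tensor_iso ι X₀ B₀.X
  exact ⟨B₀.baseChange ℂ, X₀ ⊗ B₀.X, by rw [AbelianVariety.dim_baseChange, hB₀], ⟨whiskerRightIso e _ ≪≫ φ.symm⟩⟩

end BaseChange

/-! ## §2 Per variety isomorphic to a base change: the paddings stay inside the `ℚ̄`-world (modulo (N)+(E)+(c)) -/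

section Padding

variable (ι : AlgebraicClosure ℚ →+* ℂ) {n : ℕ} {X : SchemeOver ℂ} {X₀ : SchemeOver (AlgebraicClosure ℚ)}

/-- **OFFSET `−k`, per variety `X ≅ X₀ ⊗_ι ℂ`** (modulo (N)+(E)+(c)): if every absolute Hodge class of codimension `q ≥ 2` on every
smooth projective `Y₀ ⊗_ι ℂ` of dimension `2q + k` (`Y₀` over `ℚ̄`) is algebraic, then every absolute Hodge class of codimension
`p ≥ 2` on `X` is algebraic — pad DOWN by the bare pull-back to `X ⊗ B.X ≅ (X₀ ⊗ B₀) ⊗_ι ℂ` (gen 69's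
`absoluteHodge_algebraic_of_prod_of_canonical`) or UP by `κʲ` (gen 71's `absoluteHodge_algebraic_of_middle_prod_of_canonical`), the
hypothesis being moved across the isomorphism by §0. The hypothesis is NOT asserted. [cite: Voisin2007HodgeLoci, Prop. 1.2 and Rem. 1.4]
[cite: Deligne1982HodgeCycles, §2 Example 2.1 (c), (d) (p. 16)] [cite: BrosnanFangNiePearlstein2009, §6 Lemma 48] -/
theorem forall_absoluteHodge_algebraic_of_two_le_of_iso_baseChangeHom_of_belowMiddleBy_of_canonical
    (hN : chartConjugation_canonical)
    (hex : ∀ ⦃n : ℕ⦄ ⦃X : SchemeOver ℂ⦄, IsSmoothProjective n X →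
      ∀ (σ : ℂ ≃+* ℂ) (p : ℕ) (c : complexBetti X (2 * p)), ∃ s, IsConjugateClass σ X (2 * p) c s)
    (h21c : deligne1982_lefschetz_absoluteHodge_iff) (k : ℕ)
    (hk : ∀ ⦃N : ℕ⦄ ⦃Y₀ : SchemeOver (AlgebraicClosure ℚ)⦄, IsSmoothProjective N ((baseChangeHom ι).obj Y₀) →
      ∀ q : ℕ, 2 ≤ q → 2 * q + k = N → ∀ z : complexBetti ((baseChangeHom ι).obj Y₀) (2 * q),
        IsAbsoluteHodgeClass N ((baseChangeHom ι).obj Y₀) q z → z ∈ algebraicClasses ((baseChangeHom ι).obj Y₀) q)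
    (hX : IsSmoothProjective n X) (e : X ≅ (baseChangeHom ι).obj X₀) (p : ℕ) (hp : 2 ≤ p) (c : complexBetti X (2 * p))
    (hc : IsAbsoluteHodgeClass n X p c) : c ∈ algebraicClasses X p := by
  by_cases hle : n ≤ 2 * p + k
  · obtain ⟨j, hj⟩ : ∃ j, 2 * p + k = n + j := ⟨2 * p + k - n, by omega⟩
    rcases Nat.eq_zero_or_pos j with rfl | hj1
    · -- `X` itself
      have hX₀ : IsSmoothProjective n ((baseChangeHom ι).obj X₀) := hX.of_iso e
      exact forall_absoluteHodge_algebraic_of_iso_of_canonical hN hex hX₀ hX e.symm (hk hX₀ p hp (by omega)) c hc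
    · -- pad DOWN by `B` of dimension `j`, defined over `ℚ̄`
      obtain ⟨B, Y₀, hBd, ⟨ψ⟩⟩ := exists_abelianVariety_tensor_iso_baseChangeHom ι e (j - 1)
      have hXB : IsSmoothProjective (n + B.dim) (X ⊗ B.X) :=
        IsSmoothProjective.tensor_holds hX (AbelianVariety.isSmoothProjective_holds (A := B))
      have hY : IsSmoothProjective (n + B.dim) ((baseChangeHom ι).obj Y₀) := hXB.of_iso ψ
      exact absoluteHodge_algebraic_of_prod_of_canonical hN hex hX B
        (forall_absoluteHodge_algebraic_of_iso_of_canonical hN hex hY hXB ψ.symm (hk hY p hp (by omega))) c hc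
  · -- pad UP by `κʲ`, `B` of dimension `j = n − 2p − k`, defined over `ℚ̄`
    obtain ⟨j, hj⟩ : ∃ j, 2 * p + k + j = n := ⟨n - 2 * p - k, by omega⟩
    obtain ⟨B, Y₀, hBd, ⟨ψ⟩⟩ := exists_abelianVariety_tensor_iso_baseChangeHom ι e (j - 1)
    have hBsp : IsSmoothProjective B.dim B.X := AbelianVariety.isSmoothProjective_holds (A := B)
    obtain ⟨κ, hκ⟩ := exists_isPolarizationClass hBsp
    have hXB : IsSmoothProjective (n + B.dim) (X ⊗ B.X) := IsSmoothProjective.tensor_holds hX hBsp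
    have hY : IsSmoothProjective (n + B.dim) ((baseChangeHom ι).obj Y₀) := hXB.of_iso ψ
    exact absoluteHodge_algebraic_of_middle_prod_of_canonical hN hex h21c hX hBsp hκ
      (forall_absoluteHodge_algebraic_of_iso_of_canonical hN hex hY hXB ψ.symm (hk hY (p + B.dim) (by omega) (by omega))) c hc

/-- **OFFSET `+k`, per variety `X ≅ X₀ ⊗_ι ℂ`** (modulo (N)+(E)+(c)): if every absolute Hodge class of codimension `q` with
`2q = N + k`, `2 ≤ q ≤ N − 2` on every smooth projective `Y₀ ⊗_ι ℂ` of dimension `N` is algebraic, then every absolute Hodge class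
of codimension `2 ≤ p`, `2p ≤ n` on `X` is algebraic (pad UP by `κʲ`, `j = (n − 2p) + k`). The hypothesis is NOT asserted.
[cite: Voisin2007HodgeLoci, Prop. 1.2 and Rem. 1.4] [cite: Deligne1982HodgeCycles, §2 Example 2.1 (c), (d) (p. 16)]
[cite: BrosnanFangNiePearlstein2009, §6 Lemma 48] -/
theorem forall_absoluteHodge_algebraic_lowerHalf_of_iso_baseChangeHom_of_aboveMiddleBy_of_canonical
    (hN : chartConjugation_canonical)
    (hex : ∀ ⦃n : ℕ⦄ ⦃X : SchemeOver ℂ⦄, IsSmoothProjective n X →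
      ∀ (σ : ℂ ≃+* ℂ) (p : ℕ) (c : complexBetti X (2 * p)), ∃ s, IsConjugateClass σ X (2 * p) c s)
    (h21c : deligne1982_lefschetz_absoluteHodge_iff) (k : ℕ)
    (hk : ∀ ⦃N : ℕ⦄ ⦃Y₀ : SchemeOver (AlgebraicClosure ℚ)⦄, IsSmoothProjective N ((baseChangeHom ι).obj Y₀) →
      ∀ q : ℕ, 2 ≤ q → q + 2 ≤ N → 2 * q = N + k → ∀ z : complexBetti ((baseChangeHom ι).obj Y₀) (2 * q),
        IsAbsoluteHodgeClass N ((baseChangeHom ι).obj Y₀) q z → z ∈ algebraicClasses ((baseChangeHom ι).obj Y₀) q)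
    (hX : IsSmoothProjective n X) (e : X ≅ (baseChangeHom ι).obj X₀) (p : ℕ) (hp : 2 ≤ p) (hpn : 2 * p ≤ n)
    (c : complexBetti X (2 * p)) (hc : IsAbsoluteHodgeClass n X p c) : c ∈ algebraicClasses X p := by
  obtain ⟨j, hj⟩ : ∃ j, 2 * p + j = n + k := ⟨n + k - 2 * p, by omega⟩
  rcases Nat.eq_zero_or_pos j with rfl | hj1
  · have hX₀ : IsSmoothProjective n ((baseChangeHom ι).obj X₀) := hX.of_iso e
    exact forall_absoluteHodge_algebraic_of_iso_of_canonical hN hex hX₀ hX e.symm (hk hX₀ p hp (by omega) (by omega)) c hc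
  · obtain ⟨B, Y₀, hBd, ⟨ψ⟩⟩ := exists_abelianVariety_tensor_iso_baseChangeHom ι e (j - 1)
    have hBsp : IsSmoothProjective B.dim B.X := AbelianVariety.isSmoothProjective_holds (A := B)
    obtain ⟨κ, hκ⟩ := exists_isPolarizationClass hBsp
    have hXB : IsSmoothProjective (n + B.dim) (X ⊗ B.X) := IsSmoothProjective.tensor_holds hX hBsp
    have hY : IsSmoothProjective (n + B.dim) ((baseChangeHom ι).obj Y₀) := hXB.of_iso ψ
    exact absoluteHodge_algebraic_of_middle_prod_of_canonical hN hex h21c hX hBsp hκ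
      (forall_absoluteHodge_algebraic_of_iso_of_canonical hN hex hY hXB ψ.symm
        (hk hY (p + B.dim) (by omega) (by omega) (by omega))) c hc

end Padding

/-! ## §3 The `ℚ̄`-node at a fixed offset `±k` from the middle (modulo (N)+(E)+(c)) -/

section QbarNode

/-- **THE `ℚ̄`-NODE AT OFFSET `−k`, FOR EVERY `k`**: granted (N), (E), (c), `AbsoluteHodgeImpliesAlgebraicQbar ↔` "for every
`ι : ℚ̄ →+* ℂ`, every `Y₀/ℚ̄` with `Y₀ ⊗_ι ℂ` smooth projective of dimension `2q + k`, `q ≥ 2`, every absolute Hodge class of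
codimension `q` on `Y₀ ⊗_ι ℂ` is algebraic" (per `ι`, per `X₀`: §2 and gen 68's halving `forall_absoluteHodge_algebraic_of_lowerHalf`).
Neither side is asserted. [cite: Voisin2007HodgeLoci, Prop. 1.2 and Rem. 1.4] [cite: CharlesSchnell2014Notes, §11.2.5 Conj. 11.2.18]
[cite: Deligne1982HodgeCycles, §2 Example 2.1 (c), (d) (p. 16)] -/
theorem absoluteHodgeImpliesAlgebraicQbar_iff_belowMiddleBy_of_canonical (hN : chartConjugation_canonical)
    (hex : ∀ ⦃n : ℕ⦄ ⦃X : SchemeOver ℂ⦄, IsSmoothProjective n X →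
      ∀ (σ : ℂ ≃+* ℂ) (p : ℕ) (c : complexBetti X (2 * p)), ∃ s, IsConjugateClass σ X (2 * p) c s)
    (h21c : deligne1982_lefschetz_absoluteHodge_iff) (k : ℕ) :
    AbsoluteHodgeImpliesAlgebraicQbar ↔
      ∀ (ι : AlgebraicClosure ℚ →+* ℂ) ⦃N : ℕ⦄ ⦃Y₀ : SchemeOver (AlgebraicClosure ℚ)⦄,
        IsSmoothProjective N ((baseChangeHom ι).obj Y₀) → ∀ q : ℕ, 2 ≤ q → 2 * q + k = N →
          ∀ z : complexBetti ((baseChangeHom ι).obj Y₀) (2 * q), IsAbsoluteHodgeClass N ((baseChangeHom ι).obj Y₀) q z →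
            z ∈ algebraicClasses ((baseChangeHom ι).obj Y₀) q :=
  ⟨fun h ι _ _ hY q _ _ z hz ↦ h ι hY q z hz,
    fun h ι _ _ hX p c hc ↦ forall_absoluteHodge_algebraic_of_lowerHalf h21c hX
      (fun q hq _ d hd ↦ forall_absoluteHodge_algebraic_of_two_le_of_iso_baseChangeHom_of_belowMiddleBy_of_canonical ι hN hex
        h21c k (h ι) hX (Iso.refl _) q hq d hd) p c hc⟩

/-- **THE `ℚ̄`-NODE AT OFFSET `+k`, FOR EVERY `k`**: granted (N), (E), (c), `AbsoluteHodgeImpliesAlgebraicQbar ↔` "for every `ι`,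
every `Y₀/ℚ̄` with `Y₀ ⊗_ι ℂ` smooth projective of dimension `N` and every `q` with `2q = N + k`, `2 ≤ q ≤ N − 2`, every absolute Hodge
class of codimension `q` on `Y₀ ⊗_ι ℂ` is algebraic". Neither side is asserted. [cite: Voisin2007HodgeLoci, Prop. 1.2 and Rem. 1.4]
[cite: CharlesSchnell2014Notes, §11.2.5 Conj. 11.2.18] [cite: Deligne1982HodgeCycles, §2 Example 2.1 (c), (d) (p. 16)] -/
theorem absoluteHodgeImpliesAlgebraicQbar_iff_aboveMiddleBy_of_canonical (hN : chartConjugation_canonical)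
    (hex : ∀ ⦃n : ℕ⦄ ⦃X : SchemeOver ℂ⦄, IsSmoothProjective n X →
      ∀ (σ : ℂ ≃+* ℂ) (p : ℕ) (c : complexBetti X (2 * p)), ∃ s, IsConjugateClass σ X (2 * p) c s)
    (h21c : deligne1982_lefschetz_absoluteHodge_iff) (k : ℕ) :
    AbsoluteHodgeImpliesAlgebraicQbar ↔
      ∀ (ι : AlgebraicClosure ℚ →+* ℂ) ⦃N : ℕ⦄ ⦃Y₀ : SchemeOver (AlgebraicClosure ℚ)⦄,
        IsSmoothProjective N ((baseChangeHom ι).obj Y₀) → ∀ q : ℕ, 2 ≤ q → q + 2 ≤ N → 2 * q = N + k →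
          ∀ z : complexBetti ((baseChangeHom ι).obj Y₀) (2 * q), IsAbsoluteHodgeClass N ((baseChangeHom ι).obj Y₀) q z →
            z ∈ algebraicClasses ((baseChangeHom ι).obj Y₀) q :=
  ⟨fun h ι _ _ hY q _ _ _ z hz ↦ h ι hY q z hz,
    fun h ι _ _ hX p c hc ↦ forall_absoluteHodge_algebraic_of_lowerHalf h21c hX
      (fun q hq hqn d hd ↦ forall_absoluteHodge_algebraic_lowerHalf_of_iso_baseChangeHom_of_aboveMiddleBy_of_canonical ι hN hex
        h21c k (h ι) hX (Iso.refl _) q hq hqn d hd) p c hc⟩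

/-- **THE `ℚ̄`-NODE IS ITS MIDDLE-DEGREE SLICE** (the case `k = 0`; modulo (N)+(E)+(c)): `AbsoluteHodgeImpliesAlgebraicQbar ↔`
"for every `ι` and every `Y₀/ℚ̄` with `Y₀ ⊗_ι ℂ` smooth projective of even dimension `2m ≥ 4`, every absolute Hodge class in the
middle degree `H^{2m}` of `Y₀ ⊗_ι ℂ` is algebraic". Neither side is asserted. [cite: Voisin2007HodgeLoci, Prop. 1.2 and Rem. 1.4]
[cite: CharlesSchnell2014Notes, §11.2.5 Conj. 11.2.18] [cite: BrosnanFangNiePearlstein2009, §6 Lemma 48] -/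
theorem absoluteHodgeImpliesAlgebraicQbar_iff_middleDegree_of_canonical (hN : chartConjugation_canonical)
    (hex : ∀ ⦃n : ℕ⦄ ⦃X : SchemeOver ℂ⦄, IsSmoothProjective n X →
      ∀ (σ : ℂ ≃+* ℂ) (p : ℕ) (c : complexBetti X (2 * p)), ∃ s, IsConjugateClass σ X (2 * p) c s)
    (h21c : deligne1982_lefschetz_absoluteHodge_iff) :
    AbsoluteHodgeImpliesAlgebraicQbar ↔
      ∀ (ι : AlgebraicClosure ℚ →+* ℂ) ⦃N : ℕ⦄ ⦃Y₀ : SchemeOver (AlgebraicClosure ℚ)⦄,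
        IsSmoothProjective N ((baseChangeHom ι).obj Y₀) → ∀ m : ℕ, 2 ≤ m → N = 2 * m →
          ∀ z : complexBetti ((baseChangeHom ι).obj Y₀) (2 * m), IsAbsoluteHodgeClass N ((baseChangeHom ι).obj Y₀) m z →
            z ∈ algebraicClasses ((baseChangeHom ι).obj Y₀) m :=
  (absoluteHodgeImpliesAlgebraicQbar_iff_belowMiddleBy_of_canonical hN hex h21c 0).trans
    ⟨fun h ι _ _ hY m hm hN2 z hz ↦ h ι hY m hm (by omega) z hz, fun h ι _ _ hY q hq hqN z hz ↦ h ι hY q hq (by omega) z hz⟩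

end QbarNode

/-! ## §4 With Voisin 2007 (c7): the parent node is the `ℚ̄`-middle slice (modulo c7 + (N)+(E)+(c)) -/

section Voisin

/-- **THE PARENT NODE `↔` "ABSOLUTE HODGE CLASSES IN THE MIDDLE DEGREE OF SMOOTH PROJECTIVE VARIETIES DEFINED OVER `ℚ̄` ARE
ALGEBRAIC"** — for ONE fixed embedding `ι : ℚ̄ →+* ℂ` (modulo Voisin's Prop. 1.2 = c7 and (N)+(E)+(c)): `AbsoluteHodgeImpliesAlgebraic ↔`
"for every `Y₀/ℚ̄` with `Y₀ ⊗_ι ℂ` smooth projective of even dimension `2m ≥ 4`, every absolute Hodge class in `H^{2m}((Y₀ ⊗_ι ℂ)(ℂ); ℂ)`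
is algebraic". `⟹` restriction; `⟸`: the `ℚ̄`-hypothesis gives "absolute Hodge ⟹ algebraic" on every `X₀ ⊗_ι ℂ` (§2 + gen 68's halving),
and Voisin's Prop. 1.2 / Rem. 1.4 (`voisin2007_hodgeConjecture_absolute_of_qbar`, the tree's refereed named fact, displayed as the
hypothesis `hV`) lifts that to all smooth projective complex varieties. Charles–Schnell Conj. 11.2.18 reduced to middle-degree classes on
varieties defined over `ℚ̄`; c7, (N), (E), (c) and both sides NOT asserted. [cite: Voisin2007HodgeLoci, Prop. 1.2 and Rem. 1.4]
[cite: CharlesSchnell2014Notes, §11.2.5 Conj. 11.2.18 and Thm. 11.4.7] [cite: BrosnanFangNiePearlstein2009, §6 Lemma 48] -/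
theorem absoluteHodgeImpliesAlgebraic_iff_qbar_middleDegree_of_voisin_of_canonical
    (hV : voisin2007_hodgeConjecture_absolute_of_qbar) (hN : chartConjugation_canonical)
    (hex : ∀ ⦃n : ℕ⦄ ⦃X : SchemeOver ℂ⦄, IsSmoothProjective n X →
      ∀ (σ : ℂ ≃+* ℂ) (p : ℕ) (c : complexBetti X (2 * p)), ∃ s, IsConjugateClass σ X (2 * p) c s)
    (h21c : deligne1982_lefschetz_absoluteHodge_iff) (ι : AlgebraicClosure ℚ →+* ℂ) :
    AbsoluteHodgeImpliesAlgebraic ↔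
      ∀ ⦃N : ℕ⦄ ⦃Y₀ : SchemeOver (AlgebraicClosure ℚ)⦄, IsSmoothProjective N ((baseChangeHom ι).obj Y₀) →
        ∀ m : ℕ, 2 ≤ m → N = 2 * m →
          ∀ z : complexBetti ((baseChangeHom ι).obj Y₀) (2 * m), IsAbsoluteHodgeClass N ((baseChangeHom ι).obj Y₀) m z →
            z ∈ algebraicClasses ((baseChangeHom ι).obj Y₀) m := by
  refine ⟨fun h N Y₀ hY m _ _ z hz ↦ h hY m z hz, fun h n X hX p c hc ↦ hV ι ?_ hX p c hc⟩
  intro n' X₀ hX₀ p' c' hc'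
  exact forall_absoluteHodge_algebraic_of_lowerHalf h21c hX₀
    (fun q hq _ d hd ↦ forall_absoluteHodge_algebraic_of_two_le_of_iso_baseChangeHom_of_belowMiddleBy_of_canonical ι hN hex h21c 0
      (fun N Y₀ hY q' hq' hqN z hz ↦ h hY q' hq' (by omega) z hz) hX₀ (Iso.refl _) q hq d hd) p' c' hc'

/-- **The parent node `↔` the `ℚ̄`-slice at offset `−k`, for every `k` and one fixed `ι`** (modulo c7 + (N)+(E)+(c)): absolute Hodge
classes of codimension `q ≥ 2` on smooth projective `Y₀ ⊗_ι ℂ` of dimension `2q + k`, `Y₀/ℚ̄`. Nothing asserted.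
[cite: Voisin2007HodgeLoci, Prop. 1.2 and Rem. 1.4] [cite: CharlesSchnell2014Notes, §11.2.5 Conj. 11.2.18] -/
theorem absoluteHodgeImpliesAlgebraic_iff_qbar_belowMiddleBy_of_voisin_of_canonical
    (hV : voisin2007_hodgeConjecture_absolute_of_qbar) (hN : chartConjugation_canonical)
    (hex : ∀ ⦃n : ℕ⦄ ⦃X : SchemeOver ℂ⦄, IsSmoothProjective n X →
      ∀ (σ : ℂ ≃+* ℂ) (p : ℕ) (c : complexBetti X (2 * p)), ∃ s, IsConjugateClass σ X (2 * p) c s)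
    (h21c : deligne1982_lefschetz_absoluteHodge_iff) (ι : AlgebraicClosure ℚ →+* ℂ) (k : ℕ) :
    AbsoluteHodgeImpliesAlgebraic ↔
      ∀ ⦃N : ℕ⦄ ⦃Y₀ : SchemeOver (AlgebraicClosure ℚ)⦄, IsSmoothProjective N ((baseChangeHom ι).obj Y₀) →
        ∀ q : ℕ, 2 ≤ q → 2 * q + k = N →
          ∀ z : complexBetti ((baseChangeHom ι).obj Y₀) (2 * q), IsAbsoluteHodgeClass N ((baseChangeHom ι).obj Y₀) q z →
            z ∈ algebraicClasses ((baseChangeHom ι).obj Y₀) q := by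
  refine ⟨fun h N Y₀ hY q _ _ z hz ↦ h hY q z hz, fun h n X hX p c hc ↦ hV ι ?_ hX p c hc⟩
  intro n' X₀ hX₀ p' c' hc'
  exact forall_absoluteHodge_algebraic_of_lowerHalf h21c hX₀
    (fun q hq _ d hd ↦ forall_absoluteHodge_algebraic_of_two_le_of_iso_baseChangeHom_of_belowMiddleBy_of_canonical ι hN hex h21c k
      h hX₀ (Iso.refl _) q hq d hd) p' c' hc'

/-- **The parent node `↔` the `ℚ̄`-slice at offset `+k`, for every `k` and one fixed `ι`** (modulo c7 + (N)+(E)+(c)): absolute Hodge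
classes of codimension `q` on smooth projective `Y₀ ⊗_ι ℂ` of dimension `N`, `2q = N + k`, `2 ≤ q ≤ N − 2`. Nothing asserted.
[cite: Voisin2007HodgeLoci, Prop. 1.2 and Rem. 1.4] [cite: CharlesSchnell2014Notes, §11.2.5 Conj. 11.2.18] -/
theorem absoluteHodgeImpliesAlgebraic_iff_qbar_aboveMiddleBy_of_voisin_of_canonical
    (hV : voisin2007_hodgeConjecture_absolute_of_qbar) (hN : chartConjugation_canonical)
    (hex : ∀ ⦃n : ℕ⦄ ⦃X : SchemeOver ℂ⦄, IsSmoothProjective n X →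
      ∀ (σ : ℂ ≃+* ℂ) (p : ℕ) (c : complexBetti X (2 * p)), ∃ s, IsConjugateClass σ X (2 * p) c s)
    (h21c : deligne1982_lefschetz_absoluteHodge_iff) (ι : AlgebraicClosure ℚ →+* ℂ) (k : ℕ) :
    AbsoluteHodgeImpliesAlgebraic ↔
      ∀ ⦃N : ℕ⦄ ⦃Y₀ : SchemeOver (AlgebraicClosure ℚ)⦄, IsSmoothProjective N ((baseChangeHom ι).obj Y₀) →
        ∀ q : ℕ, 2 ≤ q → q + 2 ≤ N → 2 * q = N + k →
          ∀ z : complexBetti ((baseChangeHom ι).obj Y₀) (2 * q), IsAbsoluteHodgeClass N ((baseChangeHom ι).obj Y₀) q z →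
            z ∈ algebraicClasses ((baseChangeHom ι).obj Y₀) q := by
  refine ⟨fun h N Y₀ hY q _ _ _ z hz ↦ h hY q z hz, fun h n X hX p c hc ↦ hV ι ?_ hX p c hc⟩
  intro n' X₀ hX₀ p' c' hc'
  exact forall_absoluteHodge_algebraic_of_lowerHalf h21c hX₀
    (fun q hq hqn d hd ↦ forall_absoluteHodge_algebraic_lowerHalf_of_iso_baseChangeHom_of_aboveMiddleBy_of_canonical ι hN hex h21c k
      h hX₀ (Iso.refl _) q hq hqn d hd) p' c' hc'

/-- **Row b06 from the `ℚ̄`-middle hypothesis** (modulo c7 + (N)+(E)+(c)): if for one `ι` every absolute Hodge class in the middle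
degree of every smooth projective `Y₀ ⊗_ι ℂ` (`Y₀/ℚ̄`, even dimension `≥ 4`) is algebraic, then `AbsoluteHodgeImpliesAlgebraicAV`
(through the parent node). Nothing asserted; row b06 NOT discharged. [cite: Voisin2007HodgeLoci, Prop. 1.2 and Rem. 1.4]
[cite: Deligne1982HodgeCycles, Intro pp. 5–7] -/
theorem absoluteHodgeImpliesAlgebraicAV_of_qbar_middleDegree_of_voisin_of_canonical
    (hV : voisin2007_hodgeConjecture_absolute_of_qbar) (hN : chartConjugation_canonical)
    (hex : ∀ ⦃n : ℕ⦄ ⦃X : SchemeOver ℂ⦄, IsSmoothProjective n X →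
      ∀ (σ : ℂ ≃+* ℂ) (p : ℕ) (c : complexBetti X (2 * p)), ∃ s, IsConjugateClass σ X (2 * p) c s)
    (h21c : deligne1982_lefschetz_absoluteHodge_iff) (ι : AlgebraicClosure ℚ →+* ℂ)
    (h : ∀ ⦃N : ℕ⦄ ⦃Y₀ : SchemeOver (AlgebraicClosure ℚ)⦄, IsSmoothProjective N ((baseChangeHom ι).obj Y₀) →
      ∀ m : ℕ, 2 ≤ m → N = 2 * m →
        ∀ z : complexBetti ((baseChangeHom ι).obj Y₀) (2 * m), IsAbsoluteHodgeClass N ((baseChangeHom ι).obj Y₀) m z →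
          z ∈ algebraicClasses ((baseChangeHom ι).obj Y₀) m) :
    AbsoluteHodgeImpliesAlgebraicAV :=
  absoluteHodgeImpliesAlgebraicAV_of_all
    ((absoluteHodgeImpliesAlgebraic_iff_qbar_middleDegree_of_voisin_of_canonical hV hN hex h21c ι).2 h)

/-- **The same keyed to (N), (G), (c), c7** ((E) from Grothendieck's comparison fact (G)). None of the four facts is asserted.
[cite: Voisin2007HodgeLoci, Prop. 1.2 and Rem. 1.4] [cite: CharlesSchnell2014Notes, §11.2.2 (11.2.1)–(11.2.3) and Conj. 11.2.18] -/
theorem absoluteHodgeImpliesAlgebraic_iff_qbar_middleDegree_of_voisin_of_grothendieck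
    (hV : voisin2007_hodgeConjecture_absolute_of_qbar) (hN : chartConjugation_canonical)
    (hG : grothendieck_comparison_realize_surjective) (h21c : deligne1982_lefschetz_absoluteHodge_iff)
    (ι : AlgebraicClosure ℚ →+* ℂ) :
    AbsoluteHodgeImpliesAlgebraic ↔
      ∀ ⦃N : ℕ⦄ ⦃Y₀ : SchemeOver (AlgebraicClosure ℚ)⦄, IsSmoothProjective N ((baseChangeHom ι).obj Y₀) →
        ∀ m : ℕ, 2 ≤ m → N = 2 * m →
          ∀ z : complexBetti ((baseChangeHom ι).obj Y₀) (2 * m), IsAbsoluteHodgeClass N ((baseChangeHom ι).obj Y₀) m z →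
            z ∈ algebraicClasses ((baseChangeHom ι).obj Y₀) m :=
  absoluteHodgeImpliesAlgebraic_iff_qbar_middleDegree_of_voisin_of_canonical hV hN (exists_isConjugateClass_even_of_grothendieck hG)
    h21c ι

end Voisin

/-! ## Audit: nothing is decided here

No theorem above concludes `AbsoluteHodgeImpliesAlgebraic`, `AbsoluteHodgeImpliesAlgebraicQbar`, `AbsoluteHodgeImpliesAlgebraicAV`,
`HC_AV` or `HC_CM` outright: §0–§1 are transport / existence statements, the rest carries the undischarged hypotheses (N), (E)/(G), (c)
and, in §4, c7 (named facts of the tree, displayed, never asserted) together with a `ℚ̄`-slice hypothesis. Axiom closures: the three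
standard axioms. -/

#print axioms Summit.HodgeConjecture.HodgeConjecture.Ring2.Hypotheses.absoluteHodgeImpliesAlgebraicQbar_iff_middleDegree_of_canonical
#print axioms Summit.HodgeConjecture.HodgeConjecture.Ring2.Hypotheses.absoluteHodgeImpliesAlgebraic_iff_qbar_middleDegree_of_voisin_of_canonical

end Summit.HodgeConjecture.HodgeConjecture.Ring2.Hypotheses

end
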